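import Summits.BirchSwinnertonDyer.BirchSwinnertonDyer.Theses.BiquadraticEisensteinDescent
import HarnessLib

/-!
# `BiquadraticEisensteinDescent.HeegnerFieldSupplyCMInertBadKPrimeOfParts` holds (route BiquadraticEisensteinDescent, W-ALL
# row 12 · K12i; item stmt-BirchSwinnertonDyer-21382 = the GLUE of the split of the K′-supply crux KS_R, stmt-20713)

`HeegnerFieldSupplyCMInertBadKPrimeOfParts := BeckwithRaumRichterResidueInput → HeegnerClassNumberSupplyCMInertBadOfBRR →
HeegnerTwistCouplingInSupply → HeegnerFieldSupplyCMInertBadKPrime`: the printed input (BRR 2022 Thm. 1, by name) feeds the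
class-number-supply child (`BRR2022 → ∀ (W,p) corner ∀ B, ∃ K′ …`), whose `∀B`-family the coupling child turns into the KS_R
witness. Pure plumbing (the route author's certificate SplitCheckKSR-g11.lean, evidence #14 on stmt-20713); no mathematics
beyond composition. THEOREMS ONLY (0 definitions, 0 named facts, 0 `sorry`). BSD is not proved by this file.
Prover seat bsd-wall-bed-p2 (g7), 2026-08-27. References: [BeckwithRaumRichter2022] Adv. Math. 409 (2022), Thm. 1.
-/

set_option autoImplicit false

-- D-0017 layout: summit = sub-problem, so `Summit.BirchSwinnertonDyer.BirchSwinnertonDyer.…` is the mandated namespace.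
set_option linter.dupNamespace false

namespace Summit.BirchSwinnertonDyer.BirchSwinnertonDyer.Theorems.BiquadraticEisensteinDescentHeegnerFieldSupplyCMInertBadKPrimeOfParts

open Summit.BirchSwinnertonDyer.BirchSwinnertonDyer.Theses.BiquadraticEisensteinDescent

/-- **The glue `HeegnerFieldSupplyCMInertBadKPrimeOfParts` holds**: from the BRR 2022 input, the class-number supply (for
every bound) and the twist-coupling child, the K′-supply crux KS_R follows at every pair `(W, p)` of the corner — apply the
coupling child to the `∀B`-family produced by the supply child fed with the input. [cite: BeckwithRaumRichter2022, Theorem 1] -/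
theorem heegnerFieldSupplyCMInertBadKPrimeOfParts_proof : HeegnerFieldSupplyCMInertBadKPrimeOfParts := by
  intro h22 hB hC W _ _ p _ _ hCM hr hp5 hin hbad
  exact hC W p hCM hr hp5 hin hbad (hB h22 W p hCM hr hp5 hin hbad)

end Summit.BirchSwinnertonDyer.BirchSwinnertonDyer.Theorems.BiquadraticEisensteinDescentHeegnerFieldSupplyCMInertBadKPrimeOfParts
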